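import Mathlib

/-!
# Value rigidity from few unequal short edges (Lemma T)

A purely combinatorial lemma, the second half of the "99 %" additive-coincidence rigidity
theorem (`SoloInformedAdditiveCoincidenceRigidity`).  Let `S ⊆ [1, K]` miss at most `K / 100`
points of `[1, K]`, let `Good` (the *good differences*) contain all but at most `K / 100`
points of `[1, K / 4]`, and for every difference `u` let `B u` be a finite set of *unequal lower
endpoints*.  Suppose a labelling `c : ℕ → α` satisfies `c (a + u) = c a` whenever `u ∈ Good`,
`a, a + u ∈ S` and `a ∉ B u` (every good edge not recorded in `B` is an *equal* edge), and that
the total number `W = ∑_{u ∈ Good} #(B u)` of recorded edges satisfies `4000 W ≤ K²`.  Then `c`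
is constant on `S` off fewer than `80 W / K` points: `c s = c₀` for all `s ∈ S` outside a set
`X` with `#X · (K / 40 + 1) ≤ 2 W`.

Proof outline.  The *degree* of `x` is the number of recorded edges at `x` (as a lower or as
an upper endpoint); degrees sum to at most `2 W` over `S` (double counting), so the set `NT` of
points of `S` of degree `> K / 40` satisfies `(K / 40 + 1) · #NT ≤ 2 W`, whence `50 · #NT ≤ K`.
On the *tame* points (degree `≤ K / 40`) the labelling is constant: two tame points at distance
`k ≤ K / 8` have a common neighbour joined to both by unrecorded good edges (pigeonhole over
`K / 4 - k` candidate differences against at most `K / 100 + 2 · K / 100 + 2 · K / 40`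
exclusions), and a longer gap between tame points is split at an intermediate tame point
(pigeonhole against the at most `K / 100 + K / 50` non-tame integers in the gap; strong
induction on the gap).  Every point of `S` with `c s ≠ c₀` (`c₀` the common tame value) is then
non-tame.  No novelty is claimed; the constants are convenient, not optimal.
-/

namespace Summit.Schanuel.Schanuel.Theorems

/-- **Lemma T (value rigidity from few unequal short edges).**
Let `K ≥ 1000`, `S ⊆ [1, K]` with `100 · #([1, K] \ S) ≤ K`, `Good ⊆ ℕ` with
`100 · #([1, K / 4] \ Good) ≤ K`, and `B : ℕ → Finset ℕ` with `4000 · ∑_{u ∈ Good} #(B u) ≤ K · K`.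
If `c : ℕ → α` satisfies `c (a + u) = c a` for all `u ∈ Good` and `a, a + u ∈ S` with `a ∉ B u`,
then `c s = c₀` for some `c₀ : α` and all `s ∈ S` outside a finite set `X` with
`#X · (K / 40 + 1) ≤ 2 · ∑_{u ∈ Good} #(B u)`. -/
theorem soloAV_eq_const_off_sparse {α : Type*} {K : ℕ} (hK : 1000 ≤ K) {S : Finset ℕ}
    (hS : S ⊆ Finset.Icc 1 K) (hE : 100 * (Finset.Icc 1 K \ S).card ≤ K)
    {Good : Finset ℕ} (hNG : 100 * (Finset.Icc 1 (K / 4) \ Good).card ≤ K)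
    (B : ℕ → Finset ℕ) (hW : 4000 * ∑ u ∈ Good, (B u).card ≤ K * K)
    (c : ℕ → α) (hc : ∀ u ∈ Good, ∀ a ∈ S, a + u ∈ S → a ∉ B u → c (a + u) = c a) :
    ∃ c₀ : α, ∃ X : Finset ℕ, X.card * (K / 40 + 1) ≤ 2 * ∑ u ∈ Good, (B u).card ∧
      ∀ s ∈ S, s ∉ X → c s = c₀ := by
  classical
  -- the exceptional sets `E`, `NG`, the scale `Q = K / 4`, the edge count `W`
  obtain ⟨E, hEdef⟩ : ∃ E : Finset ℕ, E = Finset.Icc 1 K \ S := ⟨_, rfl⟩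
  have hEc : 100 * E.card ≤ K := by rw [hEdef]; exact hE
  obtain ⟨Q, hQ⟩ : ∃ Q : ℕ, Q = K / 4 := ⟨_, rfl⟩
  obtain ⟨NG, hNGdef⟩ : ∃ NG : Finset ℕ, NG = Finset.Icc 1 Q \ Good := ⟨_, rfl⟩
  have hNGc : 100 * NG.card ≤ K := by rw [hNGdef, hQ]; exact hNG
  obtain ⟨W, hWdef⟩ : ∃ W : ℕ, W = ∑ u ∈ Good, (B u).card := ⟨_, rfl⟩
  have hWc : 4000 * W ≤ K * K := by rw [hWdef]; exact hW
  rw [← hWdef]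
  have memS : ∀ x, 1 ≤ x → x ≤ K → x ∉ E → x ∈ S := by
    intro x h1 h2 h3
    by_contra h4
    exact h3 (by rw [hEdef]; exact Finset.mem_sdiff.mpr ⟨Finset.mem_Icc.mpr ⟨h1, h2⟩, h4⟩)
  have Ssub : ∀ x ∈ S, 1 ≤ x ∧ x ≤ K := fun x hx => Finset.mem_Icc.mp (hS hx)
  have memG : ∀ u, 1 ≤ u → u ≤ Q → u ∉ NG → u ∈ Good := by
    intro u h1 h2 h3
    by_contra h4
    exact h3 (by rw [hNGdef]; exact Finset.mem_sdiff.mpr ⟨Finset.mem_Icc.mpr ⟨h1, h2⟩, h4⟩)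
  -- degrees: recorded edges at `x` as a lower (`D₁`) or as an upper (`D₂`) endpoint
  obtain ⟨D₁, hD₁⟩ : ∃ D₁ : ℕ → Finset ℕ, ∀ x, D₁ x = Good.filter (fun u => x ∈ B u) :=
    ⟨_, fun _ => rfl⟩
  obtain ⟨D₂, hD₂⟩ : ∃ D₂ : ℕ → Finset ℕ,
      ∀ x, D₂ x = Good.filter (fun u => u ≤ x ∧ x - u ∈ B u) := ⟨_, fun _ => rfl⟩
  have memD₁ : ∀ x u, u ∈ Good → x ∈ B u → u ∈ D₁ x := by
    intro x u hu hx
    rw [hD₁]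
    exact Finset.mem_filter.mpr ⟨hu, hx⟩
  have memD₂ : ∀ x u, u ∈ Good → u ≤ x → x - u ∈ B u → u ∈ D₂ x := by
    intro x u hu hux hx
    rw [hD₂]
    exact Finset.mem_filter.mpr ⟨hu, hux, hx⟩
  have sum₁ : ∑ x ∈ S, (D₁ x).card ≤ W := by
    calc ∑ x ∈ S, (D₁ x).card
        = ∑ x ∈ S, ∑ u ∈ Good, (if x ∈ B u then 1 else 0) := by
          refine Finset.sum_congr rfl (fun x _ => ?_)
          rw [hD₁, Finset.card_filter]
      _ = ∑ u ∈ Good, ∑ x ∈ S, (if x ∈ B u then 1 else 0) := Finset.sum_comm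
      _ = ∑ u ∈ Good, (S.filter (fun x => x ∈ B u)).card := by
          refine Finset.sum_congr rfl (fun u _ => ?_)
          rw [Finset.card_filter]
      _ ≤ ∑ u ∈ Good, (B u).card := by
          refine Finset.sum_le_sum (fun u _ => Finset.card_le_card (fun x hx => ?_))
          exact (Finset.mem_filter.mp hx).2
      _ = W := hWdef.symm
  have sum₂ : ∑ x ∈ S, (D₂ x).card ≤ W := by
    calc ∑ x ∈ S, (D₂ x).card
        = ∑ x ∈ S, ∑ u ∈ Good, (if (u ≤ x ∧ x - u ∈ B u) then 1 else 0) := by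
          refine Finset.sum_congr rfl (fun x _ => ?_)
          rw [hD₂, Finset.card_filter]
      _ = ∑ u ∈ Good, ∑ x ∈ S, (if (u ≤ x ∧ x - u ∈ B u) then 1 else 0) := Finset.sum_comm
      _ = ∑ u ∈ Good, (S.filter (fun x => u ≤ x ∧ x - u ∈ B u)).card := by
          refine Finset.sum_congr rfl (fun u _ => ?_)
          rw [Finset.card_filter]
      _ ≤ ∑ u ∈ Good, (B u).card := by
          refine Finset.sum_le_sum (fun u _ => ?_)
          refine Finset.card_le_card_of_injOn (fun x => x - u) (fun x hx => ?_) ?_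
          · exact Finset.mem_coe.mpr (Finset.mem_filter.mp (Finset.mem_coe.mp hx)).2.2
          · intro x hx y hy hxy
            have hx' := (Finset.mem_filter.mp (Finset.mem_coe.mp hx)).2.1
            have hy' := (Finset.mem_filter.mp (Finset.mem_coe.mp hy)).2.1
            simp only at hxy
            omega
      _ = W := hWdef.symm
  obtain ⟨deg, hdeg⟩ : ∃ deg : ℕ → ℕ, ∀ x, deg x = (D₁ x).card + (D₂ x).card :=
    ⟨_, fun _ => rfl⟩
  have sumdeg : ∑ x ∈ S, deg x ≤ 2 * W := by
    have h : ∑ x ∈ S, deg x = ∑ x ∈ S, (D₁ x).card + ∑ x ∈ S, (D₂ x).card := by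
      rw [← Finset.sum_add_distrib]
      exact Finset.sum_congr rfl (fun x _ => hdeg x)
    omega
  -- the non-tame points
  obtain ⟨NT, hNTdef⟩ : ∃ NT : Finset ℕ, NT = S.filter (fun x => K / 40 < deg x) := ⟨_, rfl⟩
  have hNTc : NT.card * (K / 40 + 1) ≤ 2 * W := by
    have h1 : NT.card * (K / 40 + 1) ≤ ∑ x ∈ NT, deg x := by
      have h := Finset.card_nsmul_le_sum NT deg (K / 40 + 1) (fun x hx => by
        rw [hNTdef] at hx
        exact (Finset.mem_filter.mp hx).2)
      rw [smul_eq_mul] at h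
      exact h
    have h2 : ∑ x ∈ NT, deg x ≤ ∑ x ∈ S, deg x :=
      Finset.sum_le_sum_of_subset (by rw [hNTdef]; exact Finset.filter_subset _ _)
    exact h1.trans (h2.trans sumdeg)
  have hNTlin : 50 * NT.card ≤ K := by
    have h5 : K ≤ 40 * (K / 40 + 1) := by omega
    have h6 : NT.card * K ≤ NT.card * (40 * (K / 40 + 1)) := Nat.mul_le_mul_left _ h5
    have h8 : K * (50 * NT.card) ≤ K * K := by
      calc K * (50 * NT.card) = 50 * (NT.card * K) := by ring
        _ ≤ 50 * (NT.card * (40 * (K / 40 + 1))) := Nat.mul_le_mul_left _ h6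
        _ = 2000 * (NT.card * (K / 40 + 1)) := by ring
        _ ≤ 2000 * (2 * W) := Nat.mul_le_mul_left _ hNTc
        _ = 4000 * W := by ring
        _ ≤ K * K := hWc
    exact Nat.le_of_mul_le_mul_left h8 (by omega)
  -- an intermediate tame point of `S` in every gap longer than `Q / 2`
  have dense : ∀ a b : ℕ, a + Q / 2 < b → b ≤ K →
      ∃ x, a < x ∧ x < b ∧ x ∈ S ∧ deg x ≤ K / 40 := by
    intro a b hab hbK
    have hcard : (E ∪ NT).card < (Finset.Ioo a b).card := by
      refine (Finset.card_union_le _ _).trans_lt ?_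
      rw [Nat.card_Ioo]; omega
    obtain ⟨x, hxI, hxB⟩ := Finset.exists_mem_notMem_of_card_lt_card hcard
    rw [Finset.mem_Ioo] at hxI
    rw [Finset.mem_union, not_or] at hxB
    have xS : x ∈ S := memS x (by omega) (by omega) hxB.1
    refine ⟨x, hxI.1, hxI.2, xS, ?_⟩
    by_contra h
    exact hxB.2 (by rw [hNTdef]; exact Finset.mem_filter.mpr ⟨xS, by omega⟩)
  -- unions of five finite sets
  have card5 : ∀ X₁ X₂ X₃ X₄ X₅ : Finset ℕ, (X₁ ∪ X₂ ∪ X₃ ∪ X₄ ∪ X₅).card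
      ≤ X₁.card + X₂.card + X₃.card + X₄.card + X₅.card := by
    intro X₁ X₂ X₃ X₄ X₅
    have h4 := Finset.card_union_le (X₁ ∪ X₂ ∪ X₃ ∪ X₄) X₅
    have h3 := Finset.card_union_le (X₁ ∪ X₂ ∪ X₃) X₄
    have h2 := Finset.card_union_le (X₁ ∪ X₂) X₃
    have h1 := Finset.card_union_le X₁ X₂
    omega
  -- two tame points at distance `k ≤ Q / 2` carry the same value
  have short : ∀ s k : ℕ, 1 ≤ k → k ≤ Q / 2 → s ∈ S → deg s ≤ K / 40 →
      s + k ∈ S → deg (s + k) ≤ K / 40 → c (s + k) = c s := by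
    intro s k hk1 hk2 hs hds hsk hdsk
    have hs1 := Ssub s hs
    have hsk1 := Ssub (s + k) hsk
    have hd1 : (D₁ s).card ≤ K / 40 := by have := hdeg s; omega
    have hd2 : (D₂ s).card ≤ K / 40 := by have := hdeg s; omega
    have hd3 : (D₁ (s + k)).card ≤ K / 40 := by have := hdeg (s + k); omega
    have hd4 : (D₂ (s + k)).card ≤ K / 40 := by have := hdeg (s + k); omega
    by_cases hA : s + Q ≤ K
    · -- a common upper neighbour `s + u`, found by pigeonhole over `u ∈ [k + 1, Q]`
      have hcard : (E.image (fun x => x - s) ∪ NG ∪ NG.image (fun v => v + k) ∪ D₁ s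
          ∪ (D₁ (s + k)).image (fun v => v + k)).card < (Finset.Icc (k + 1) Q).card := by
        refine (card5 _ _ _ _ _).trans_lt ?_
        have i1 : (E.image (fun x => x - s)).card ≤ E.card := Finset.card_image_le
        have i2 : (NG.image (fun v => v + k)).card ≤ NG.card := Finset.card_image_le
        have i3 : ((D₁ (s + k)).image (fun v => v + k)).card ≤ (D₁ (s + k)).card :=
          Finset.card_image_le
        rw [Nat.card_Icc]; omega
      obtain ⟨u, huI, huB⟩ := Finset.exists_mem_notMem_of_card_lt_card hcard
      rw [Finset.mem_Icc] at huI
      simp only [Finset.mem_union, not_or] at huB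
      obtain ⟨⟨⟨⟨hu1, hu2⟩, hu3⟩, hu4⟩, hu5⟩ := huB
      have suS : s + u ∈ S := memS (s + u) (by omega) (by omega)
        (fun h => hu1 (Finset.mem_image.mpr ⟨s + u, h, Nat.add_sub_cancel_left s u⟩))
      have uG : u ∈ Good := memG u (by omega) huI.2 hu2
      have ukG : u - k ∈ Good := memG (u - k) (by omega) (by omega)
        (fun h => hu3 (Finset.mem_image.mpr ⟨u - k, h, Nat.sub_add_cancel (by omega)⟩))
      have hsB : s ∉ B u := fun h => hu4 (memD₁ s u uG h)
      have hskB : s + k ∉ B (u - k) := fun h => hu5 (Finset.mem_image.mpr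
        ⟨u - k, memD₁ (s + k) (u - k) ukG h, Nat.sub_add_cancel (by omega)⟩)
      have e1 : c (s + u) = c s := hc u uG s hs suS hsB
      have h1 : s + k + (u - k) = s + u := by omega
      have e2 : c (s + k + (u - k)) = c (s + k) :=
        hc (u - k) ukG (s + k) hsk (by rw [h1]; exact suS) hskB
      rw [h1] at e2
      exact e2.symm.trans e1
    · -- a common lower neighbour `m`, found by pigeonhole over `m ∈ [s + k - Q, s - 1]`
      have hB' : K < s + Q := not_le.mp hA
      have hcard : (E ∪ NG.image (fun v => s - v) ∪ NG.image (fun v => s + k - v)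
          ∪ (D₂ s).image (fun v => s - v) ∪ (D₂ (s + k)).image (fun v => s + k - v)).card
          < (Finset.Icc (s + k - Q) (s - 1)).card := by
        refine (card5 _ _ _ _ _).trans_lt ?_
        have i1 : (NG.image (fun v => s - v)).card ≤ NG.card := Finset.card_image_le
        have i2 : (NG.image (fun v => s + k - v)).card ≤ NG.card := Finset.card_image_le
        have i3 : ((D₂ s).image (fun v => s - v)).card ≤ (D₂ s).card := Finset.card_image_le
        have i4 : ((D₂ (s + k)).image (fun v => s + k - v)).card ≤ (D₂ (s + k)).card :=
          Finset.card_image_le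
        rw [Nat.card_Icc]; omega
      obtain ⟨m, hmI, hmB⟩ := Finset.exists_mem_notMem_of_card_lt_card hcard
      rw [Finset.mem_Icc] at hmI
      simp only [Finset.mem_union, not_or] at hmB
      obtain ⟨⟨⟨⟨hm1, hm2⟩, hm3⟩, hm4⟩, hm5⟩ := hmB
      have mS : m ∈ S := memS m (by omega) (by omega) hm1
      have vG : s - m ∈ Good := memG (s - m) (by omega) (by omega)
        (fun h => hm2 (Finset.mem_image.mpr ⟨s - m, h, Nat.sub_sub_self (by omega)⟩))
      have vkG : s + k - m ∈ Good := memG (s + k - m) (by omega) (by omega)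
        (fun h => hm3 (Finset.mem_image.mpr ⟨s + k - m, h, Nat.sub_sub_self (by omega)⟩))
      have hv1 : s - (s - m) = m := Nat.sub_sub_self (by omega)
      have hv2 : s + k - (s + k - m) = m := Nat.sub_sub_self (by omega)
      have hmB1 : m ∉ B (s - m) := fun h => hm4 (Finset.mem_image.mpr
        ⟨s - m, memD₂ s (s - m) vG (by omega) (by rw [hv1]; exact h), hv1⟩)
      have hmB2 : m ∉ B (s + k - m) := fun h => hm5 (Finset.mem_image.mpr
        ⟨s + k - m, memD₂ (s + k) (s + k - m) vkG (by omega) (by rw [hv2]; exact h), hv2⟩)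
      have h1 : m + (s - m) = s := by omega
      have h2 : m + (s + k - m) = s + k := by omega
      have e1 : c (m + (s - m)) = c m := hc (s - m) vG m mS (by rw [h1]; exact hs) hmB1
      have e2 : c (m + (s + k - m)) = c m :=
        hc (s + k - m) vkG m mS (by rw [h2]; exact hsk) hmB2
      rw [h1] at e1
      rw [h2] at e2
      rw [e2, e1]
  -- tame points at any distance carry the same value (split long gaps at a tame point)
  have chain : ∀ k : ℕ, ∀ s, s ∈ S → deg s ≤ K / 40 → s + k ∈ S → deg (s + k) ≤ K / 40 →
      c (s + k) = c s := by
    intro k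
    induction k using Nat.strong_induction_on with
    | _ k ih =>
      intro s hs hds hsk hdsk
      rcases Nat.eq_zero_or_pos k with h0 | hpos
      · subst h0; simp
      · by_cases hkQ : k ≤ Q / 2
        · exact short s k hpos hkQ hs hds hsk hdsk
        · have hlt : Q / 2 < k := not_le.mp hkQ
          obtain ⟨x, hx1, hx2, xS, hdx⟩ := dense s (s + k) (by omega) (Ssub _ hsk).2
          have g1 : s + (x - s) = x := by omega
          have g2 : x + (s + k - x) = s + k := by omega
          have h1 := ih (x - s) (by omega) s hs hds (by rw [g1]; exact xS) (by rw [g1]; exact hdx)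
          have h2 := ih (s + k - x) (by omega) x xS hdx (by rw [g2]; exact hsk)
            (by rw [g2]; exact hdsk)
          rw [g1] at h1
          rw [g2] at h2
          rw [h2, h1]
  have const : ∀ x, x ∈ S → deg x ≤ K / 40 → ∀ y, y ∈ S → deg y ≤ K / 40 → c x = c y := by
    intro x hx hdx y hy hdy
    rcases le_total x y with hxy | hxy
    · have g : x + (y - x) = y := by omega
      have h := chain (y - x) x hx hdx (by rw [g]; exact hy) (by rw [g]; exact hdy)
      rw [g] at h
      exact h.symm
    · have g : y + (x - y) = x := by omega
      have h := chain (x - y) y hy hdy (by rw [g]; exact hx) (by rw [g]; exact hdx)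
      rw [g] at h
      exact h
  -- the common tame value (any value if there is no tame point); the exceptions lie in `NT`
  by_cases hT : ∃ x, x ∈ S ∧ deg x ≤ K / 40
  · obtain ⟨x₀, hx₀, hdx₀⟩ := hT
    refine ⟨c x₀, NT, hNTc, fun s hs hsNT => ?_⟩
    refine const s hs ?_ x₀ hx₀ hdx₀
    by_contra h
    exact hsNT (by rw [hNTdef]; exact Finset.mem_filter.mpr ⟨hs, by omega⟩)
  · refine ⟨c 0, NT, hNTc, fun s hs hsNT => ?_⟩
    exfalso
    refine hsNT ?_
    rw [hNTdef]
    refine Finset.mem_filter.mpr ⟨hs, ?_⟩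
    by_contra h
    exact hT ⟨s, hs, by omega⟩

end Summit.Schanuel.Schanuel.Theorems
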